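import Summits.KontsevichZagierPeriods.KontsevichZagierPeriods.Theorems.LinRedNormalFormArrangementNormalFormSeparateDominated
import Summits.KontsevichZagierPeriods.KontsevichZagierPeriods.Theorems.LinRedNormalFormArrangementNormalFormSeparateBaseChange

/-!
# Separation along a rational direction (line `janus-bands`, crux `ArrangementNormalForm`)

The per-piece step of the wall-free reduction for `stub_separatePos`, in every base dimension
`b + 2 ≥ 2` and coordinate-free: let `s` be a Janus band representation (literal `JJ (b+2) k`
data) and `v ∈ ℚ^{b+2}` a rational direction, presented as the last column of an invertible
rational matrix `Ainv = A⁻¹` (so that after the base change `x = A⁻¹ x̃` of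
`separatePos_baseChange` the coordinate `x̃_{b+1}` moves along `v`). If every letter `L_j` with
`∂_v L_j = (vecMul L_j A⁻¹)_{last} ≠ 0` (and `e_j ≠ 0`) does not vanish on the domain, and the
RATIO condition `|L_{j'}| ≤ C |∂_v L_j · L_{j'} − ∂_v L_{j'} · L_j|` holds on the domain for every
ordered pair of such letters that are not proportional after normalisation (the right-hand side
is the `v`-free resultant form: it vanishes exactly on the WALL through `{L_j = L_{j'} = 0}` in
direction `v`), then `[s]` is congruent modulo `KZ.relations` to a `ℤ`-combination of elements of
the intermediate class `GG♮ (b+1) k` (`SeparatePos.GNset`): `separatePos_direction`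
(registered sub-goal) = `separatePos_baseChange` + `separatePos_carry`; and
`separatePos_direction_free`: if the transformed numerator is `ỹ`-free, the output is in the
skeleton class `GG (b+1) 1 k` itself (`separatePos_of_dominated`).

What is left for `stub_separatePos` after this file: (i) the existence, after a fine rational
dissection (`separatePos_cut`), of such a direction for every piece; (ii) the additive split of
the numerator (`GG♮ → GG`, `separatePos_split`: termwise absolute convergence).

(i) in BASE DIMENSION 2 (paper proof, not formalised). Letters non-vanishing on the open piece
(cut first along all letter lines). Let `X` be the finite set of crossing points of pairs of
non-parallel letter lines (rational points; parallel distinct lines have a constant non-zero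
resultant, proportional ones are excluded), `Δ` their minimal mutual distance. Cut by the two
axis-parallel lines through every `q ∈ X` and by a uniform rational grid of mesh `ε ≪ Δ / #X`.
A piece `Q` lies in a grid rectangle `R` of side `≤ ε` whose sides are CONSECUTIVE cut
coordinates, so every `q ∈ X` has `q.x ∉ (x_a, x_{a+1})` and `q.y ∉ (y_b, y_{b+1})`: `R` lies in
a closed quadrant at `q`, i.e. `R̄` is seen from `q` within a closed sector of angle `≤ π/2`, and
within angle `O(ε/Δ)` if `dist(q, R) ≥ Δ/3` (all but at most one `q`). The ratio condition for
the pair crossing at `q` and direction `v` holds on `Q` as soon as `±v` avoid that sector with a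
margin: then `|n_v · (z − q)| ≥ c |z − q|` on `R` (`n_v ⊥ v`; for the quadrant case
`|n₁ u₁ + n₂ u₂| = |n₁||u₁| + |n₂||u₂|` by sign coherence), while `|L_{j'}(z)| ≤ ‖∇L_{j'}‖ |z − q|`
and the resultant is `α_j α_{j'}` times the `v`-free form vanishing on `q + ℝ v`. The forbidden
directions have total angle `≤ π + O(#X · ε/Δ) < 2π`, so a rational `v` with margin exists.
Base dimension `≥ 3`: open (at the corner of `{x, y, z > 0}` with letter pairs through the three
coordinate axes no direction works; the chamber dissection `{x_σ1 > x_σ2 > x_σ3}` restores one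
axis per piece — a general chamber lemma is unproved).
-/

noncomputable section

open Set MeasureTheory MvPolynomial

namespace Summit.KontsevichZagierPeriods.ArrangementNormalForm.JanusBands

open Literature.NumberTheory.Transcendental

open SeparatePos in
/-- **Separation along a rational direction** (registered sub-goal of `stub_separatePos`;
`separatePos_baseChange` followed by `separatePos_carry`). See the module docstring. -/
theorem separatePos_direction (b k m m' : ℕ) (s : KZ.IntegralRep (b + 2 + k)) (M : Fin m' → (Fin (b + 2) → ℚ) × ℚ) (L : Fin m → (Fin (b + 2) → ℚ) × ℚ) (e : Fin m → ℕ) (p : MvPolynomial (Fin (b + 2)) ℚ) (a : Fin k → Option ((Fin (b + 2) → ℚ) × ℚ)) (lo hi : Fin k → Fin k ⊕ ((Fin (b + 2) → ℚ) × ℚ)) (hbd : Bornology.IsBounded s.domain) (hdom : s.domain = {z | (∀ j, 0 < ∑ i, ((M j).1 i : ℝ) * z (Fin.castAdd k i) + ((M j).2 : ℝ)) ∧ ∀ i, Sum.elim (fun j => z (Fin.natAdd (b + 2) j)) (fun c => ∑ i', (c.1 i' : ℝ) * z (Fin.castAdd k i') + (c.2 : ℝ)) (lo i) < z (Fin.natAdd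 (b + 2) i) ∧ z (Fin.natAdd (b + 2) i) < Sum.elim (fun j => z (Fin.natAdd (b + 2) j)) (fun c => ∑ i', (c.1 i' : ℝ) * z (Fin.castAdd k i') + (c.2 : ℝ)) (hi i)}) (hint : EqOn s.integrand (fun z => MvPolynomial.aeval (fun i => z (Fin.castAdd k i)) p / (∏ j, (∑ i, ((L j).1 i : ℝ) * z (Fin.castAdd k i) + ((L j).2 : ℝ)) ^ e j) * ∏ i, (a i).elim 1 (fun c => 1 / (z (Fin.natAdd (b + 2) i) - (∑ i', (c.1 i' : ℝ) * z (Fin.castAdd k i') + (c.2 : ℝ))))) s.domain) (A Ainv : Matrix (Fin (b + 2)) (Fin (b + 2)) ℚ) (hA : A * Ainv = 1) (hA' : Ainv * A = 1) (hpole : ∀ j, Matrix.vecMul (L j).1 Ainv (Fin.last (b + 1)) ≠ 0 → e j ≠ 0 → ∀ z ∈ s.domain, ∑ i, ((L j).1 i : ℝ) * z (Fin.castAdd k i) + ((L j).2 : ℝ) ≠ 0) (hrat : ∀ j j', Matrix.vecMul (L j).1 Ainv (Fin.last (b + 1)) ≠ 0 → Matrix.vecMul (L j').1 Ainv (Fin.last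 (b + 1)) ≠ 0 → e j ≠ 0 → e j' ≠ 0 → Matrix.vecMul (L j').1 Ainv (Fin.last (b + 1)) • L j ≠ Matrix.vecMul (L j).1 Ainv (Fin.last (b + 1)) • L j' → ∃ C : ℝ, ∀ z ∈ s.domain, |∑ i, ((L j').1 i : ℝ) * z (Fin.castAdd k i) + ((L j').2 : ℝ)| ≤ C * |((Matrix.vecMul (L j).1 Ainv (Fin.last (b + 1)) : ℚ) : ℝ) * (∑ i, ((L j').1 i : ℝ) * z (Fin.castAdd k i) + ((L j').2 : ℝ)) - ((Matrix.vecMul (L j').1 Ainv (Fin.last (b + 1)) : ℚ) : ℝ) * (∑ i, ((L j).1 i : ℝ) * z (Fin.castAdd k i) + ((L j).2 : ℝ))|) : ∃ c ∈ AddSubgroup.closure {w : KZ.FormalRep | ∃ (m m' n : ℕ) (s : KZ.IntegralRep (b + 1 + 1 + k)) (M : Fin m' → (Fin (b + 1 + 1) → ℚ) × ℚ) (L : Fin m → (Fin (b + 1) → ℚ) × ℚ) (e : Fin m → ℕ) (p : MvPolynomial (Fin (b + 1 + 1)) ℚ) (ℓ : (Fin (b + 1) → ℚ) × ℚ) (a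 : Fin k → Option ((Fin (b + 1 + 1) → ℚ) × ℚ)) (lo hi : Fin k → Fin k ⊕ ((Fin (b + 1 + 1) → ℚ) × ℚ)), (n ≠ 0 → ∀ z ∈ s.domain, z (Fin.castAdd k (Fin.last (b + 1))) - (∑ i, (ℓ.1 i : ℝ) * z (Fin.castAdd k (Fin.castSucc i)) + (ℓ.2 : ℝ)) ≠ 0) ∧ Bornology.IsBounded s.domain ∧ s.domain = {z | (∀ j, 0 < ∑ i, ((M j).1 i : ℝ) * z (Fin.castAdd k i) + ((M j).2 : ℝ)) ∧ ∀ i, Sum.elim (fun j => z (Fin.natAdd (b + 1 + 1) j)) (fun c => ∑ i', (c.1 i' : ℝ) * z (Fin.castAdd k i') + (c.2 : ℝ)) (lo i) < z (Fin.natAdd (b + 1 + 1) i) ∧ z (Fin.natAdd (b + 1 + 1) i) < Sum.elim (fun j => z (Fin.natAdd (b + 1 + 1) j)) (fun c => ∑ i', (c.1 i' : ℝ) * z (Fin.castAdd k i') + (c.2 : ℝ)) (hi i)} ∧ EqOn s.integrand (fun z => MvPolynomial.aeval (fun i => z (Fin.castAdd k i)) p / (∏ j, (∑ i, ((L j).1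 i : ℝ) * z (Fin.castAdd k (Fin.castSucc i)) + ((L j).2 : ℝ)) ^ e j) * (1 / (z (Fin.castAdd k (Fin.last (b + 1))) - (∑ i, (ℓ.1 i : ℝ) * z (Fin.castAdd k (Fin.castSucc i)) + (ℓ.2 : ℝ))) ^ n) * ∏ i, (a i).elim 1 (fun c => 1 / (z (Fin.natAdd (b + 1 + 1) i) - (∑ i', (c.1 i' : ℝ) * z (Fin.castAdd k i') + (c.2 : ℝ))))) s.domain ∧ w = KZ.of s}, KZ.of s - c ∈ KZ.relations := by
  obtain ⟨M', L', p', a', lo', hi', s', -, hL', -, -, -, -, hΨ, hbd', hdom', hint', hrel⟩ :=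
    separatePos_baseChange (b + 2) k m m' s M L e p a lo hi hbd hdom hint A Ainv hA hA'
  refine (separatePos_carry (b + 1) k m m' s' M' L' e p' a' lo' hi' hbd' hdom'
    hint' (fun j hα he w hw => ?pole) (fun j j' hα hα' he he' hne => ?rat)).imp
    fun c hc => ⟨hc.1, ?main⟩
  case main =>
    have h := add_mem hrel hc.2
    rwa [sub_add_sub_cancel] at h
  case pole =>
    simp only [hL'] at hα ⊢
    have h := hpole j hα he _ ((hΨ w).1 hw)
    rwa [form_sub] at h
  case rat =>
    simp only [hL'] at hα hα' hne ⊢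
    have hne' : Matrix.vecMul (L j').1 Ainv (Fin.last (b + 1)) • L j ≠
        Matrix.vecMul (L j).1 Ainv (Fin.last (b + 1)) • L j' := fun h => by
      have h2 := congrArg (fun c : (Fin (b + 2) → ℚ) × ℚ => (Matrix.vecMul c.1 Ainv, c.2)) h
      exact hne (by simpa only [Prod.smul_fst, Prod.smul_snd, Matrix.smul_vecMul, Prod.smul_mk]
        using h2)
    obtain ⟨C, hC⟩ := hrat j j' hα hα' he he' hne'
    refine ⟨C, fun w hw => ?_⟩
    have h := hC _ ((hΨ w).1 hw)
    rwa [form_sub, form_sub] at h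

open SeparatePos in
/-- **Separation along a rational direction, `ỹ`-free numerator** (corollary, not registered):
if moreover the transformed numerator `p ∘ A⁻¹` does not involve the new distinguished
coordinate (`bind₁ (A⁻¹ ·) p = rename Fin.castSucc p₀`, e.g. `p` constant), the output lies in
the skeleton class `GG (b+1) 1 k` itself (`separatePos_baseChange` + `separatePos_of_dominated`). -/
theorem separatePos_direction_free (GG : ℕ → ℕ → ℕ → Set KZ.FormalRep) (hGG : ∀ b σ k, GG b σ k = {w : KZ.FormalRep | ∃ (m m' n₁ n₂ : ℕ) (s : KZ.IntegralRep (b + 1 + k)) (M : Fin m' → (Fin (b + 1) → ℚ) × ℚ) (L : Fin m → (Fin b → ℚ) × ℚ) (e : Fin m → ℕ) (p : MvPolynomial (Fin b) ℚ) (ℓ₁ ℓ₂ : (Fin b → ℚ) × ℚ) (a : Fin k → Option ((Fin (b + 1) → ℚ) × ℚ)) (lo hi : Fin k → Fin k ⊕ ((Fin (b + 1) → ℚ) × ℚ)), (n₁ = 0 ∨ n₂ = 0) ∧ (σ = 2 → (∀ i c, a i = some c → c.1 (Fin.last b) = 0) ∧ (∀ i c, (lo i = Sum.inr c ∨ hi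 i = Sum.inr c) → (c.1 (Fin.last b) = 0 ∨ c = (Pi.single (Fin.last b) 1, 0)))) ∧ Bornology.IsBounded s.domain ∧ s.domain = {z | (∀ j, 0 < ∑ i, ((M j).1 i : ℝ) * z (Fin.castAdd k i) + ((M j).2 : ℝ)) ∧ ∀ i, Sum.elim (fun j => z (Fin.natAdd (b + 1) j)) (fun c => ∑ i', (c.1 i' : ℝ) * z (Fin.castAdd k i') + (c.2 : ℝ)) (lo i) < z (Fin.natAdd (b + 1) i) ∧ z (Fin.natAdd (b + 1) i) < Sum.elim (fun j => z (Fin.natAdd (b + 1) j)) (fun c => ∑ i', (c.1 i' : ℝ) * z (Fin.castAdd k i') + (c.2 : ℝ)) (hi i)} ∧ EqOn s.integrand (fun z => MvPolynomial.aeval (fun i => z (Fin.castAdd k (Fin.castSucc i))) p / (∏ j, (∑ i, ((L j).1 i : ℝ) * z (Fin.castAdd k (Fin.castSucc i)) + ((L j).2 : ℝ)) ^ e j) * ((z (Fin.castAdd k (Fin.last b)) - (∑ i, (ℓ₁.1 i : ℝ) * z (Fin.castAdd k (Fin.castSucc i)) + (ℓ₁.2 : ℝ))) ^ n₁ / (z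 (Fin.castAdd k (Fin.last b)) - (∑ i, (ℓ₂.1 i : ℝ) * z (Fin.castAdd k (Fin.castSucc i)) + (ℓ₂.2 : ℝ))) ^ n₂) * ∏ i, (a i).elim 1 (fun c => 1 / (z (Fin.natAdd (b + 1) i) - (∑ i', (c.1 i' : ℝ) * z (Fin.castAdd k i') + (c.2 : ℝ))))) s.domain ∧ w = KZ.of s}) (b k m m' : ℕ) (s : KZ.IntegralRep (b + 2 + k)) (M : Fin m' → (Fin (b + 2) → ℚ) × ℚ) (L : Fin m → (Fin (b + 2) → ℚ) × ℚ) (e : Fin m → ℕ) (p : MvPolynomial (Fin (b + 2)) ℚ) (a : Fin k → Option ((Fin (b + 2) → ℚ) × ℚ)) (lo hi : Fin k → Fin k ⊕ ((Fin (b + 2) → ℚ) × ℚ)) (hbd : Bornology.IsBounded s.domain) (hdom : s.domain = {z | (∀ j, 0 < ∑ i, ((M j).1 i : ℝ) * z (Fin.castAdd k i) + ((M j).2 : ℝ)) ∧ ∀ i, Sum.elim (fun j => z (Fin.natAdd (b + 2) j)) (fun c => ∑ i', (c.1 i' : ℝ) * z (Fin.castAdd k i') + (c.2 : ℝ)) (lo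 i) < z (Fin.natAdd (b + 2) i) ∧ z (Fin.natAdd (b + 2) i) < Sum.elim (fun j => z (Fin.natAdd (b + 2) j)) (fun c => ∑ i', (c.1 i' : ℝ) * z (Fin.castAdd k i') + (c.2 : ℝ)) (hi i)}) (hint : EqOn s.integrand (fun z => MvPolynomial.aeval (fun i => z (Fin.castAdd k i)) p / (∏ j, (∑ i, ((L j).1 i : ℝ) * z (Fin.castAdd k i) + ((L j).2 : ℝ)) ^ e j) * ∏ i, (a i).elim 1 (fun c => 1 / (z (Fin.natAdd (b + 2) i) - (∑ i', (c.1 i' : ℝ) * z (Fin.castAdd k i') + (c.2 : ℝ))))) s.domain) (A Ainv : Matrix (Fin (b + 2)) (Fin (b + 2)) ℚ) (hA : A * Ainv = 1) (hA' : Ainv * A = 1) (hpole : ∀ j, Matrix.vecMul (L j).1 Ainv (Fin.last (b + 1)) ≠ 0 → e j ≠ 0 → ∀ z ∈ s.domain, ∑ i, ((L j).1 i : ℝ) * z (Fin.castAdd k i) + ((L j).2 : ℝ) ≠ 0) (hrat : ∀ j j', Matrix.vecMul (L j).1 Ainv (Fin.last (b + 1)) ≠ 0 → Matrix.vecMul (L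 j').1 Ainv (Fin.last (b + 1)) ≠ 0 → e j ≠ 0 → e j' ≠ 0 → Matrix.vecMul (L j').1 Ainv (Fin.last (b + 1)) • L j ≠ Matrix.vecMul (L j).1 Ainv (Fin.last (b + 1)) • L j' → ∃ C : ℝ, ∀ z ∈ s.domain, |∑ i, ((L j').1 i : ℝ) * z (Fin.castAdd k i) + ((L j').2 : ℝ)| ≤ C * |((Matrix.vecMul (L j).1 Ainv (Fin.last (b + 1)) : ℚ) : ℝ) * (∑ i, ((L j').1 i : ℝ) * z (Fin.castAdd k i) + ((L j').2 : ℝ)) - ((Matrix.vecMul (L j').1 Ainv (Fin.last (b + 1)) : ℚ) : ℝ) * (∑ i, ((L j).1 i : ℝ) * z (Fin.castAdd k i) + ((L j).2 : ℝ))|) (p₀ : MvPolynomial (Fin (b + 1)) ℚ) (hp : MvPolynomial.bind₁ (fun i => ∑ j, MvPolynomial.C (Ainv i j) * MvPolynomial.X j) p = MvPolynomial.rename Fin.castSucc p₀) : ∃ c ∈ AddSubgroup.closure (GG (b + 1) 1 k), KZ.of s - c ∈ KZ.relations := by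
  obtain ⟨M', L', p', a', lo', hi', s', -, hL', hp', -, -, -, hΨ, hbd', hdom', hint', hrel⟩ :=
    separatePos_baseChange (b + 2) k m m' s M L e p a lo hi hbd hdom hint A Ainv hA hA'
  have hP : p' = MvPolynomial.rename Fin.castSucc (MvPolynomial.C |Ainv.det| * p₀) := by
    rw [hp', hp, map_mul, MvPolynomial.rename_C]
  rw [hP] at hint'
  refine (separatePos_of_dominated GG hGG (b + 1) k m m' s' M' L' e _ a' lo' hi'
    hbd' hdom' hint' (fun j hα he w hw => ?pole) (fun j j' hα hα' he he' hne => ?rat)).imp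
    fun c hc => ⟨hc.1, ?main⟩
  case main =>
    have h := add_mem hrel hc.2
    rwa [sub_add_sub_cancel] at h
  case pole =>
    simp only [hL'] at hα ⊢
    have h := hpole j hα he _ ((hΨ w).1 hw)
    rwa [form_sub] at h
  case rat =>
    simp only [hL'] at hα hα' hne ⊢
    have hne' : Matrix.vecMul (L j').1 Ainv (Fin.last (b + 1)) • L j ≠
        Matrix.vecMul (L j).1 Ainv (Fin.last (b + 1)) • L j' := fun h => by
      have h2 := congrArg (fun c : (Fin (b + 2) → ℚ) × ℚ => (Matrix.vecMul c.1 Ainv, c.2)) h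
      exact hne (by simpa only [Prod.smul_fst, Prod.smul_snd, Matrix.smul_vecMul, Prod.smul_mk]
        using h2)
    obtain ⟨C, hC⟩ := hrat j j' hα hα' he he' hne'
    refine ⟨C, fun w hw => ?_⟩
    have h := hC _ ((hΨ w).1 hw)
    rwa [form_sub, form_sub] at h

end Summit.KontsevichZagierPeriods.ArrangementNormalForm.JanusBands
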